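import Summits.QuantumFields.YangMills.Theorems.BalabanUVNodesN06D2SupPrechainV2AtPinsPUWQJ
import HarnessLib

/-!
# N06 [B9] — «P-H♭» F2: ROW 26 AT SLOT (a) — (3.132)-SHAPE FOR `(QG_AQ*)⁻¹` AT PRINT's KNIT PAIR, ALONG A SUB-FAMILY `f : J → MemberY …`, FROM THE CERTIFICATE's
# G₀-LAYER (2.51) ENTRY `he0` AND THE ROW-17-FED COERCIVITY `hcoA` — NO (3.130)∕(3.138) STEP TRANSFER

Cell `pub-ymgap` (HUMAN RULING D-0062, Track A), node N06 = [Balaban1985BackgroundPropagators] («[B9]»); seat `pub-ymgap-dag-n06-l` (g42), 2026-08-31; node00-def-Y g39's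
(J1) RULING («the slot-(a) (3.133) row is yours to pen … by the METHOD of Thm 3.12: Thm 3.3 for `G₀` + the (3.132)-analogue for `(QG₀Q*)⁻¹` «as for (3.48)» + the p.422 step»);
dag-lead WORDS 802.  `--supports stmt-QuantumFields-27239 --as helper`; count-neutral.  [4] = [Balaban1984PropagatorsII].

THE PRINT.  [B9] p. 422: «The operators (QG̃Q*)⁻¹, or (QG₁Q*)⁻¹, can be analyzed in the same way as the operator (Q′G′²Q′*)⁻¹ … |(QGQ*)⁻¹(y, y′)| ≦ O(1)(Lʲη)⁻²(L^{j′}η)^{−d}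
e^{−δ₁d(y,y′)} (3.132)»; p. 421 «G₀ = (Δ + DRD* + Q*aQ)⁻¹» (3.26)–(3.27); Thm 3.11 p. 416 (positivity of `Δ_a`); [4] (2.142) p. 248, Lemma 2.1 (2.60)–(2.61) p. 234.

WHAT.  The certificate's row 26 (`s3132`, ✓`…D2SupPrechainV2AtPinsPUWQJ` leg (10)ᴶ) reads (3.132) for `(𝔮G̃𝔮⋆)⁻¹` by the chain «(2.51) entries of `G̃`, `G̃ − G₀` ⟹ `DecayUnder`
(✓`decayUnder_QGQOfQY_knit_of_majorants_R_J`) and `CoerciveUnder (𝔮G₀𝔮⋆)` (✓`hcoA_of_testFamily_QR_J`, ROW 17 at section-carrying members + the inhabited test family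
✓`hTt_knit_of_pins`) transferred to `𝔮G̃𝔮⋆` (✓`coerciveUnder_of_subMajorants_knit_R_J`) ⟹ Combes–Thomas (✓`B9Eq3132NuReadingRJ.stmt3132Printed_nu_of_coercive_decay_R_J`)».
AT SLOT (a) the operator is `(𝔮G₀𝔮⋆)⁻¹` ITSELF (`G₀ = T₀ = G_A[𝔮] = Δ_a[𝔮]⁻¹`): the SAME chain with `T := T₀`, the (2.51) entry being the G₀ layer's own `he0` (pins `hblk12 ∕ hG0co12`), and NO
transfer.  ★★★ `s3132flat_knit_of_pins_J` — `B9.Stmt3132Printed (d+1) c (geo9Y ∘ f) (bg9YR …) (ν-reading of `Ring.inverse (𝔮 T₀ 𝔮⋆)`) (same)` along `f`, from: `he0` (member-wide),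
the knit regime rows `hc hRP hα′ hαQ hα3 hα2 haK hKpl hT16` (numerics, witnessed family-wide by dag-n06-d's «ZK» files), the pins `h𝔮 h𝔮s hadj hΔdef hT₀ hblk12 hG0co12 hlev hβ1 hbI0 hnbr`,
and ROW 17 `hΔ` (`IsSymmTr ∧ PosDefTr (Δ_a[𝔮])`, J-keyed — a THEOREM at section-carrying members, dag-n06-d ✓`…DeltaAInverseAtRecord` ∕ dag-n06-j ✓Thm 3.11 chain).
This is the `c2♭` input of ✓`B9Eq3133SlotAH.ineq3133flat_sup_of_letters` (P-H♭ F1, ✓p826818) in the certificate's ν-reading; F3 (the record theorem for `H♭ = G₀Q*(QG₀Q*)⁻¹`) converts it to the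
class letter and composes with `gQs2 ∕ dgQs`.

HONEST FRAMING.  By-name composition of three landed producers at `T := T₀`; every analytic input (the G₀ (2.51) entry `he0` = Thm 3.3 for `G₀` from the cube tables, ROW 17, the
regime rows) is a displayed HYPOTHESIS of the certificate or one of its theorems; nothing of [B9] asserted; count-neutral; N06 NOT discharged; K0ᴬ∕K1ᴬ not closed; one finite
`𝕋⁴` programme at fixed ε — nothing continuum ∕ OS ∕ Clay; **the Yang–Mills mass gap is NOT proved.**  0 `def`, 0 `sorry`; NEW file, nothing landed modified.
-/

noncomputable section

namespace Summit.QuantumFields.YangMills.BalabanUVNodes.N06Eq3132SlotAKnitQJ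

open Literature.MathematicalPhysics.QuantumFieldTheory.Balaban1983to89 open Literature.MathematicalPhysics.QuantumFieldTheory.Balaban1983to89.Node00 (FBondY IBondY SiteY CfgY SiteParY SiteOpY parSymY GpY GpPhysY BondOpY parBY BondParY) open Literature.MathematicalPhysics.QuantumFieldTheory.Balaban1983to89.Node00.OpsYSectDCoords (DvcoKH DvscoKH TpicoK T2coK cR39_trBasis_pos) open B9Thm39ReadingCoords (cR39 coordBound39 basisBound39) open B9Thm34Ext (toB6) open B11SectG (HasMaj BlockNorm) open B9Thm312Whole (cNorm GeoOK) open B9Thm312WholeClasses (cNormR rwt rwt_nonneg) open B9CoReadingCoords (XBK blkBK coordOpK cdBₗ) open B9CoReadingCoordsS (XSK sIK blkSK GcoS) open B9CoReadingCoordsH (XHK) open B9CoReadingCoordsTranspose (TrIdx trBasis) open B9PinMembersKLevelV1 (MemberY geo9Y) open B9BackgroundsKLevelV1R (RegFamY bg9YR MemOfFam) open B9GeoLemma21KLevelV1 (geo9Y_len_pos geo9Y_dist_triangle geo9Y_dist_comm) open B9GeoNormsKLevelV1 (geo9K geo9K_dist_nonneg) open B7Prop2SpecialUnitary (specialUnitaryUnits)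 open B9PerturbationMajorantAlgebra (Proj349Maj Thm31GpMaj hasMaj_weaken) open B9PerturbationMajorantsAtLetters (PcoK) open B9MultiscaleSmoothPartitionYNear (rNear) open B9MultiscaleSmoothPartitionYLip (CLip CLip_nonneg) open B9SmoothHolderClassP (bHZKP bHZKPG bHZPG) open B9GradViaDivLettersTransported (taxiB taxiS) open B9PerturbationSplitAtLetters (TaLcoK TbLcoKH Ta2LcoK Tb2LcoKH) open B9PerturbationL2Delta2 (D2coK) open B9SmoothHolderClassPProducers (CTel CTel_nonneg) open B9RowSum261DefiniteFaces (rowConst261 rowConst261_nonneg) open B9SectDSup (weightNorm) open B6RandomWalk (HasMajorant) open B6RandomWalkHom (HasMajorantHom) open B9Thm312WholeStepRegular (StepS LettersS3131) open B9CoReadingCoordsHolder (PK) open B9CoReadingCoordsHolderAdm (holderProbesKA) open B9RWSums343Holder (HolderProbes) open B9PerturbationMajorantAlgebra (CurrentMaj) open B9PerturbationMajorantsAtLetters (BcoKH BdcoKH) open B9Thm313WholeDir (Thm33G0DirR) open B9Thm313WholeDirInputBC (Letters313IML) open B9LettersHZAtOne (plateau_pos) open B9CoReadingCoordsInput (bHK)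 open B9CoReadingCoordsInputS (bHS) open B9CoRealizesRelAtLetters (RelB) open B9Thm33G0ProbeZeroAtCutPins (pX0_of_pins) open B6GlobalChartV1 (blkV1) open B6Ineq2142KLevelV1 (β lvl) open B6Geom246MultiLevelTorus (geomT) open Summit.QuantumFields.YangMills.BalabanUVNodes.N06HolderPinsGradedAtRecord (links_le_one) open Summit.QuantumFields.YangMills.BalabanUVNodes.N06TbHLegAtPinsPhysPU (htbH_of_pinsP43_geo9Y) open Summit.QuantumFields.YangMills.BalabanUVNodes.N06LettersSAtPinsPU (hLettersS_of_pinsP44_geo9Y) open Summit.QuantumFields.YangMills.BalabanUVNodes.N06StateClassFactsAtPinsPU (hStateFacts_of_pinsP_geo9Y) open Summit.QuantumFields.YangMills.BalabanUVNodes.N06StateProducerG0AtPinsPU (hG0S2_of_pinsP_geo9Y) open Summit.QuantumFields.YangMills.BalabanUVNodes.N06StateProducersAAtPinsPU (hProducersA_of_pinsP_geo9Y) open Summit.QuantumFields.YangMills.BalabanUVNodes.N06StateProducersBAtPinsPUW (hProducersBW_of_pinsP_geo9Y) open Summit.QuantumFields.YangMills.BalabanUVNodes.N06StatePairsAtPinsPU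 (hStatePairs_of_pinsP_geo9Y) open Summit.QuantumFields.YangMills.BalabanUVNodes.N06StateAssemblyAtPinsPUW (hStateAssemblyW_of_faces)
open scoped Matrix.Norms.L2Operator
open Summit.QuantumFields.YangMills.BalabanUVNodes.N06GDSupSubLegAtPinsPUWIPar (gdsup_sub_of_pins_inv_par) open Literature.MathematicalPhysics.QuantumFieldTheory.Balaban1983to89.Node00 (deltaAQY parBY_mem QGQOfQY GDQY QGQinvQY delta2OfQY) open Literature.MathematicalPhysics.QuantumFieldTheory.Balaban1983to89.Node00.OpsYOps312OfRecordPar (S0coKq QcoKHq CcoKq) open Literature.MathematicalPhysics.QuantumFieldTheory.Balaban1983to89.Node00.OpsYSectDCoordsQ (S0coKq_sub_TpicoK_mul_GcoK_GDQY) open Literature.MathematicalPhysics.QuantumFieldTheory.Balaban1983to89.B9B8AveragingJunction (parKnitY) open Literature.MathematicalPhysics.QuantumFieldTheory.Balaban1983to89.B9Thm311ReadingCoords (IsAdjTr IsSymmTr PosDefTr) open Literature.MathematicalPhysics.QuantumFieldTheory.Balaban1983to89.B9Eq316AveragingTransposeZd (alphaQ) open Literature.MathematicalPhysics.QuantumFieldTheory.Balaban1983to89.B9C2FormBoxRegimeY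 (Kpl) open Literature.MathematicalPhysics.QuantumFieldTheory.Balaban1983to89.B9Eq3115KnitLetterYOnto (kCol) open Literature.MathematicalPhysics.QuantumFieldTheory.Balaban1983to89.B9Eq3132TentBumps (Cth) open Literature.MathematicalPhysics.QuantumFieldTheory.Balaban1983to89.B7Prop2Explicit (C0 c2') open Literature.MathematicalPhysics.QuantumFieldTheory.Balaban1983to89.B9BackgroundsKLevelV1P (bg9KP) open Literature.MathematicalPhysics.QuantumFieldTheory.Balaban1983to89.B6KLevelCensusIndexV1 (kGeo) open Literature.MathematicalPhysics.QuantumFieldTheory.Balaban1983to89.B9Eq3132ClassLetterFromNu (hasMaj_cNorm_weightNorm_coordOpK_geo9Y_of_ineq3132Nu) open Literature.MathematicalPhysics.QuantumFieldTheory.Balaban1983to89.B9LettersZCFieldsAtPins (const3132_le) open Literature.MathematicalPhysics.QuantumFieldTheory.Balaban1983to89.B9Thm39ReadingCoords (abs_repr_le) open Literature.MathematicalPhysics.QuantumFieldTheory.Balaban1983to89.B7Prop2SpecialUnitary (specialUnitaryUnits_le_unitaryUnits) open Summit.QuantumFields.YangMills.BalabanUVNodes.N06Eq3132DecayFromMajorantKnitQ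 (decayUnder_QGQOfQY_knit_of_majorants_R) open Summit.QuantumFields.YangMills.BalabanUVNodes.N06Eq3132CoerciveFromGAKnitQ (coerciveUnder_of_subMajorants_knit_R) open Summit.QuantumFields.YangMills.BalabanUVNodes.N06Eq3132CoerciveVariationalQ (hcoA_of_testFamily_QR) open Summit.QuantumFields.YangMills.BalabanUVNodes.N06Eq3132KnitTestFamilyQ (hTt_knit_of_pins) open Summit.QuantumFields.YangMills.BalabanUVNodes.N06SectDUnitsAtPinsPhysQ (isUnit_deltaPiAQY_of_formSmall) open Summit.QuantumFields.YangMills.BalabanUVNodes.N06D2SupLegAtPinsPUWQ (d2sup_of_pins_q) open Literature.MathematicalPhysics.QuantumFieldTheory.Balaban1983to89.B9Eq3132NuReadingR (stmt3132Printed_nu_of_coercive_decay_R) open Literature.MathematicalPhysics.QuantumFieldTheory.Balaban1983to89.B9Eq3132StepDifference (GcoK_sub) open Literature.MathematicalPhysics.QuantumFieldTheory.Balaban1983to89.B9LettersZCFieldsAtPinsB (c2_pinsB) open Literature.MathematicalPhysics.QuantumFieldTheory.Balaban1983to89.B9Thm311ReadingCoords (PosDefTr) open Literature.MathematicalPhysics.QuantumFieldTheory.Balaban1983to89.B9BackgroundsKLevelV1R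 (regY335 regY336) open Literature.MathematicalPhysics.QuantumFieldTheory.Balaban1983to89.B9RWSumsReadsNbr (nbr) open Literature.MathematicalPhysics.QuantumFieldTheory.Balaban1983to89.B9Ineq349SiteFromConv342 (contractive_of_mem) open Literature.MathematicalPhysics.QuantumFieldTheory.Balaban1983to89.B7Prop2SpecialUnitary (specialUnitaryUnits_le_unitaryUnits) open B9Thm39ReadingCoords (cR39_nonneg)
open Summit.QuantumFields.YangMills.BalabanUVNodes.N06D2SupLegAtPinsPUW (d2sup_of_pins) open Summit.QuantumFields.YangMills.BalabanUVNodes.N06SectDUnitsAtPinsPhys (isUnit_deltaPiAY_of_formSmall_phys) open Literature.MathematicalPhysics.QuantumFieldTheory.Balaban1983to89.Node00 (Stage3Params C2Y delta2OfY trDualMatY delta2PiY) open Literature.MathematicalPhysics.QuantumFieldTheory.Balaban1983to89.Node00.OpsYSectDCoords (S0coK CcoK S0coK_sub_TpicoK_mul_GcoK_GDY) open Literature.MathematicalPhysics.QuantumFieldTheory.Balaban1983to89.B9BackgroundsKLevelV1P (bg9YP) open Literature.MathematicalPhysics.QuantumFieldTheory.Balaban1983to89.B9PinGeometryKLevelV1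 (c35Y) open Literature.MathematicalPhysics.QuantumFieldTheory.Balaban1983to89.B9Eq3132SectDLetters (GDY) open Literature.MathematicalPhysics.QuantumFieldTheory.Balaban1983to89.B9Thm312Whole (FormSmall PosDefEnd) open Literature.MathematicalPhysics.QuantumFieldTheory.Balaban1983to89.B9SectDL2Decay (bl2) open Literature.MathematicalPhysics.QuantumFieldTheory.Balaban1983to89.B9Thm312WholeFormSmallFromL2 (abs_form_le_of_stepBlockBd weightedL2_le_form_of_l0) open Literature.MathematicalPhysics.QuantumFieldTheory.Balaban1983to89.B11SectG (RowSum) open Literature.MathematicalPhysics.QuantumFieldTheory.Balaban1983to89.B9GeoLemma21KLevelV1 (rowSum261_geo9Y) open B9CoReadingCoords (GcoK) open B9CoReadingCoordsH (blkHK) open B9Delta2FormMajorant (C2FormMaj)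
open Summit.QuantumFields.YangMills.BalabanUVNodes.N06Eq3132KnitTestFamilyQ (hTt_knit_of_pins)
open Literature.MathematicalPhysics.QuantumFieldTheory.Balaban1983to89.B9Eq3132NuReading (siteKernelOfOpNu nuY)

variable {N : ℕ} {θ : Stage3Params} {Mstar : ℕ}

/-- ★★★ **ROW 26 AT SLOT (a) ALONG `f`**: (3.132)-shape decay of the ν-reading of `(𝔮 G_A[𝔮] 𝔮⋆)⁻¹(U)` — `B9.Stmt3132Printed` with both slots the slot-(a) operator — for every
sub-family `f : J → MemberY …` along which ROW 17 (`hΔ`) is supplied, from the G₀ layer's (2.51) entry `he0` at the pins and the knit test family; constants `∃`-bound before `j`.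
[cite: Balaban1985BackgroundPropagators, (3.132) p.422, (3.26)–(3.27) p.395, Thm 3.11 p.416, Thm 3.12 p.423 (prefix); Balaban1984PropagatorsII, (2.142) p.248, Lemma 2.1 (2.60)–(2.61) p.234] -/
theorem s3132flat_knit_of_pins_J [NeZero N] [∀ x : MemberY θ.d₆ θ.ℓ₆ θ.hd' θ.hL' θ.b₀ θ.b₁ Mstar, Fintype (geo9Y x).Site]
    [∀ x : MemberY θ.d₆ θ.ℓ₆ θ.hd' θ.hL' θ.b₀ θ.b₁ Mstar, DecidableEq (geo9Y x).Site]
    {R₁ R₂ : RegFamY θ.d₆ θ.ℓ₆ θ.hd' θ.hL' θ.b₀ θ.b₁ Mstar (Matrix (Fin N) (Fin N) ℂ)} (H : MemberY θ.d₆ θ.ℓ₆ θ.hd' θ.hL' θ.b₀ θ.b₁ Mstar → Prop) {J : Type} (f : J → MemberY θ.d₆ θ.ℓ₆ θ.hd' θ.hL' θ.b₀ θ.b₁ Mstar)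
    (bI : ∀ x : MemberY θ.d₆ θ.ℓ₆ θ.hd' θ.hL' θ.b₀ θ.b₁ Mstar, FBondY x.toKIdx → IBondY x.toKIdx)
    (hlev : ∀ (x : MemberY θ.d₆ θ.ℓ₆ θ.hd' θ.hL' θ.b₀ θ.b₁ Mstar) (f : FBondY x.toKIdx), lvl x.hN x.D x.hk (bI x f) = (blkV1 x.hN x.D f).1.1)
    (hβ1 : ∀ (x : MemberY θ.d₆ θ.ℓ₆ θ.hd' θ.hL' θ.b₀ θ.b₁ Mstar) (f : FBondY x.toKIdx), (geomT x.D).dist (β x.hN x.D x.hk (bI x f)) (blkV1 x.hN x.D f) ≤ 1)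
    {mN : ℕ} (hnbr : ∀ (x : MemberY θ.d₆ θ.ℓ₆ θ.hd' θ.hL' θ.b₀ θ.b₁ Mstar) (y : (geo9Y x).Site), (nbr (geo9Y x) ((θ.ℓ₆ : ℝ) + 4) y).card ≤ mN)
    (c : ℝ)
    -- print's knit averaging pair and the slot-(a) form `Δ_a[𝔮]`, `T₀ = Δ_a[𝔮]⁻¹ = G₀`
    (𝔮 : ∀ x : MemberY θ.d₆ θ.ℓ₆ θ.hd' θ.hL' θ.b₀ θ.b₁ Mstar, Node00.OpsYQLetter.QLetterY (Matrix (Fin N) (Fin N) ℂ) x.toKIdx)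
    (𝔮s : ∀ x : MemberY θ.d₆ θ.ℓ₆ θ.hd' θ.hL' θ.b₀ θ.b₁ Mstar, Node00.OpsYQLetter.QsLetterY (Matrix (Fin N) (Fin N) ℂ) x.toKIdx)
    (h𝔮 : ∀ (x : MemberY θ.d₆ θ.ℓ₆ θ.hd' θ.hL' θ.b₀ θ.b₁ Mstar) (U : CfgY (Matrix (Fin N) (Fin N) ℂ) x.toKIdx), 𝔮 x U = B9Eq3115KnitLetterY.QknitY x.toKIdx U)
    (h𝔮s : ∀ (x : MemberY θ.d₆ θ.ℓ₆ θ.hd' θ.hL' θ.b₀ θ.b₁ Mstar) (U : CfgY (Matrix (Fin N) (Fin N) ℂ) x.toKIdx), 𝔮s x U = Node00.OpsYQLetter.adjTrY (B9Eq3115KnitLetterY.QknitY x.toKIdx U))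
    (hadj : ∀ (x : MemberY θ.d₆ θ.ℓ₆ θ.hd' θ.hL' θ.b₀ θ.b₁ Mstar) (α₀ : ℝ) (U : (bg9YR (Matrix (Fin N) (Fin N) ℂ) (specialUnitaryUnits (Fin N)) R₁ R₂ x).Cfg),
      (bg9YR (Matrix (Fin N) (Fin N) ℂ) (specialUnitaryUnits (Fin N)) R₁ R₂ x).Reg335 c α₀ U → B9Thm311ReadingCoords.IsAdjTr (fun _ => (1 : ℝ)) (fun _ => (1 : ℝ)) (𝔮 x U) (𝔮s x U))
    (Δ : ∀ x : MemberY θ.d₆ θ.ℓ₆ θ.hd' θ.hL' θ.b₀ θ.b₁ Mstar, CfgY (Matrix (Fin N) (Fin N) ℂ) x.toKIdx →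
      ((FBondY x.toKIdx → Matrix (Fin N) (Fin N) ℂ) →ₗ[ℂ] (FBondY x.toKIdx → Matrix (Fin N) (Fin N) ℂ)))
    (hΔdef : ∀ (x : MemberY θ.d₆ θ.ℓ₆ θ.hd' θ.hL' θ.b₀ θ.b₁ Mstar) (U : CfgY (Matrix (Fin N) (Fin N) ℂ) x.toKIdx),
      Δ x U = deltaAQY x.toKIdx (𝔮 x) (𝔮s x) (parKnitY x.toKIdx) (GpY x.toKIdx (parKnitY x.toKIdx)) U)
    (T₀ : ∀ x : MemberY θ.d₆ θ.ℓ₆ θ.hd' θ.hL' θ.b₀ θ.b₁ Mstar, BondOpY (Matrix (Fin N) (Fin N) ℂ) x.toKIdx)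
    (hT₀ : ∀ (x : MemberY θ.d₆ θ.ℓ₆ θ.hd' θ.hL' θ.b₀ θ.b₁ Mstar) (U : CfgY (Matrix (Fin N) (Fin N) ℂ) x.toKIdx), T₀ x U = Ring.inverse (Δ x U))
    -- the knit regime rows (numerics + the (3.35) class bridge)
    {c₀ : ℝ} (hc : c₀ ≤ 10)
    (hRP : ∀ (x : MemberY θ.d₆ θ.ℓ₆ θ.hd' θ.hL' θ.b₀ θ.b₁ Mstar) (α₀ : ℝ) (U : (bg9YR (Matrix (Fin N) (Fin N) ℂ) (specialUnitaryUnits (Fin N)) R₁ R₂ x).Cfg),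
      (bg9YR (Matrix (Fin N) (Fin N) ℂ) (specialUnitaryUnits (Fin N)) R₁ R₂ x).Reg335 c α₀ U → (bg9KP (Matrix (Fin N) (Fin N) ℂ) (specialUnitaryUnits (Fin N)) x.toKIdx).Reg335 c₀ α₀ U)
    {α₀' : ℝ} (hα' : 0 < α₀') (hαQ : α₀' ≤ alphaQ (θ.d₆ + 1) (θ.ℓ₆ + 1)) (hα3 : C0 (θ.d₆ + 1) * α₀' ≤ 1 / 3) (hα2 : 2 * α₀' ≤ c2' (θ.d₆ + 1) (θ.ℓ₆ + 1))
    {aK : ℝ} (haK : 0 < aK)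
    (hKpl : ∀ (x : MemberY θ.d₆ θ.ℓ₆ θ.hd' θ.hL' θ.b₀ θ.b₁ Mstar) (a : ℝ), 0 ≤ a → a ≤ aK → Kpl x.toKIdx a * (kGeo x.toKIdx).L ^ 4 < α₀')
    (hT16 : (α₀' * (2 * ((θ.d₆ : ℝ) + 1) * kCol (θ.d₆ + 1) (θ.ℓ₆ + 1) + 8 * ((θ.d₆ : ℝ) + 2) ^ 2)) ^ 2 * (2 * (N : ℝ) * θ.b₁) * (2 * ((θ.d₆ : ℝ) + 1) * Cth θ.d₆)
      ≤ θ.b₀ / 256)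
    -- the G₀-layer walk model `𝔬12` (only its block map and `G0` slot are read) and its two pins
    (𝔬12 : ∀ x : MemberY θ.d₆ θ.ℓ₆ θ.hd' θ.hL' θ.b₀ θ.b₁ Mstar, B9Thm312Whole.Ops (geo9Y x) (bg9YR (Matrix (Fin N) (Fin N) ℂ) (specialUnitaryUnits (Fin N)) R₁ R₂ x) (XBK (TrIdx N) x.toKIdx) (XBK (TrIdx N) x.toKIdx) (XHK (TrIdx N) x.toKIdx) (XSK (TrIdx N) x.toKIdx))
    (hblk12 : ∀ x : MemberY θ.d₆ θ.ℓ₆ θ.hd' θ.hL' θ.b₀ θ.b₁ Mstar, (𝔬12 x).blk = blkBK x.toKIdx (bI x))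
    (hG0co12 : ∀ (x : MemberY θ.d₆ θ.ℓ₆ θ.hd' θ.hL' θ.b₀ θ.b₁ Mstar) (U : (bg9YR (Matrix (Fin N) (Fin N) ℂ) (specialUnitaryUnits (Fin N)) R₁ R₂ x).Cfg), (𝔬12 x).G0 U = GcoK x.toKIdx (trBasis N) (bg9YR (Matrix (Fin N) (Fin N) ℂ) (specialUnitaryUnits (Fin N)) R₁ R₂ x) (fun U => U) (T₀ x) U)
    -- the G₀ layer's (2.51) entry of `G₀` (Thm 3.3 (3.42)₀ for `G₀` — the certificate's `he0`), member-wide above `(M₀, a₀)`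
    {M₀ a₀ B12₀ δ12₀ : ℝ} (ha₀ : 0 < a₀) (hB12₀ : 0 ≤ B12₀) (hδ12₀ : 0 < δ12₀)
    (he0 : ∀ x : MemberY θ.d₆ θ.ℓ₆ θ.hd' θ.hL' θ.b₀ θ.b₁ Mstar, M₀ ≤ (geo9Y x).M → ∀ α₀ : ℝ, 0 < α₀ → (geo9Y x).M * α₀ ≤ a₀ → ∀ U : (bg9YR (Matrix (Fin N) (Fin N) ℂ) (specialUnitaryUnits (Fin N)) R₁ R₂ x).Cfg, (bg9YR (Matrix (Fin N) (Fin N) ℂ) (specialUnitaryUnits (Fin N)) R₁ R₂ x).Reg335 c α₀ U → (bg9YR (Matrix (Fin N) (Fin N) ℂ) (specialUnitaryUnits (Fin N)) R₁ R₂ x).Reg336 c α₀ U →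
      HasMajorant (g := toB6 (geo9Y x) 1 (H x)) (𝔬12 x).blk ((𝔬12 x).G0 U) (fun (a b : (geo9Y x).Site) => B12₀ * (geo9Y x).len a ^ 2 * Real.exp (-(δ12₀ * (geo9Y x).dist a b))))
    -- ROW 17 along `f`: symmetry and positivity of `Δ_a[𝔮](U)` (Thm 3.11 at section-carrying members)
    (a311 M311 : ℝ) (ha311 : 0 < a311) (hM311 : 0 < M311)
    (hΔ : ∀ j : J, M311 ≤ (geo9Y (f j)).M → ∀ α₀ : ℝ, 0 < α₀ → (geo9Y (f j)).M * α₀ ≤ a311 → ∀ U : (bg9YR (Matrix (Fin N) (Fin N) ℂ) (specialUnitaryUnits (Fin N)) R₁ R₂ (f j)).Cfg, (bg9YR (Matrix (Fin N) (Fin N) ℂ) (specialUnitaryUnits (Fin N)) R₁ R₂ (f j)).Reg335 c α₀ U →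
      IsSymmTr (fun _ => (1 : ℝ)) (Δ (f j) U) ∧ PosDefTr (fun _ => (1 : ℝ)) (Δ (f j) U)) :
    B9.Stmt3132Printed (θ.d₆ + 1) c (fun j : J => geo9Y (f j)) (fun j : J => bg9YR (Matrix (Fin N) (Fin N) ℂ) (specialUnitaryUnits (Fin N)) R₁ R₂ (f j))
      (fun j => siteKernelOfOpNu (f j).toKIdx (bg9YR (Matrix (Fin N) (Fin N) ℂ) (specialUnitaryUnits (Fin N)) R₁ R₂ (f j)) (fun U => U) (nuY (θ.d₆ + 1) (f j).toKIdx)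
        (fun U => Ring.inverse (QGQOfQY (f j).toKIdx (𝔮 (f j)) (𝔮s (f j)) (T₀ (f j)) U)))
      (fun j => siteKernelOfOpNu (f j).toKIdx (bg9YR (Matrix (Fin N) (Fin N) ℂ) (specialUnitaryUnits (Fin N)) R₁ R₂ (f j)) (fun U => U) (nuY (θ.d₆ + 1) (f j).toKIdx)
        (fun U => Ring.inverse (QGQOfQY (f j).toKIdx (𝔮 (f j)) (𝔮s (f j)) (T₀ (f j)) U))) := by
  have hM01 : 0 < max M₀ 1 := lt_of_lt_of_le one_pos (le_max_right _ _)
  -- the (2.51) entry of `G₀ = T₀` at the pins, in the shape the decay producer reads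
  have hmaj0 : ∃ M₂ a₂ C δ : ℝ, 0 < M₂ ∧ 0 < a₂ ∧ 0 ≤ C ∧ 0 < δ ∧ ∀ j : J, M₂ ≤ (geo9Y (f j)).M → ∀ α₀ : ℝ, 0 < α₀ → (geo9Y (f j)).M * α₀ ≤ a₂ →
      ∀ U : (bg9YR (Matrix (Fin N) (Fin N) ℂ) (specialUnitaryUnits (Fin N)) R₁ R₂ (f j)).Cfg, (bg9YR (Matrix (Fin N) (Fin N) ℂ) (specialUnitaryUnits (Fin N)) R₁ R₂ (f j)).Reg335 c α₀ U → (bg9YR (Matrix (Fin N) (Fin N) ℂ) (specialUnitaryUnits (Fin N)) R₁ R₂ (f j)).Reg336 c α₀ U →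
        HasMajorant (g := toB6 (geo9Y (f j)) ((fun _ : MemberY θ.d₆ θ.ℓ₆ θ.hd' θ.hL' θ.b₀ θ.b₁ Mstar => (1 : ℝ)) (f j)) (H (f j))) (blkBK (f j).toKIdx (bI (f j)))
          (GcoK (f j).toKIdx (trBasis N) (bg9YR (Matrix (Fin N) (Fin N) ℂ) (specialUnitaryUnits (Fin N)) R₁ R₂ (f j)) (fun U => U) (T₀ (f j)) U)
          (fun a a' => C * (geo9Y (f j)).len a ^ 2 * Real.exp (-(δ * (geo9Y (f j)).dist a a'))) :=
    ⟨max M₀ 1, a₀, B12₀, δ12₀, hM01, ha₀, hB12₀, hδ12₀, fun j hM α₀ hα ha U hU hU' => by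
      have h := he0 (f j) ((le_max_left _ _).trans hM) α₀ hα ha U hU hU'
      rw [hblk12 (f j), hG0co12 (f j) U] at h
      exact h⟩
  have hdec := N06Eq3132DecayFromMajorantKnitQJ.decayUnder_QGQOfQY_knit_of_majorants_R_J (f := f) R₁ R₂ specialUnitaryUnits_le_unitaryUnits (trBasis N) (trBasis N)
    T₀ 𝔮 𝔮s h𝔮 h𝔮s hc hRP hα' hαQ haK hKpl hlev hβ1 hnbr (R := fun _ => (1 : ℝ)) hmaj0
  have hcoA := N06Eq3132CoerciveVariationalQJ.hcoA_of_testFamily_QR_J (f := f) Mstar R₁ R₂ (G := specialUnitaryUnits (Fin N)) 𝔮 𝔮s Δ T₀ hT₀ hadj a311 M311 ha311 hM311 hΔ _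
    (hTt_knit_of_pins θ Mstar R₁ R₂ 𝔮 𝔮s h𝔮 hadj Δ hΔdef hc hRP hα' hαQ hα3 hα2 haK hKpl hT16)
  exact B9Eq3132NuReadingRJ.stmt3132Printed_nu_of_coercive_decay_R_J (specialUnitaryUnits (Fin N)) R₁ R₂ (f := f) (trBasis N) (θ.d₆ + 1)
    (fun (x : MemberY θ.d₆ θ.ℓ₆ θ.hd' θ.hL' θ.b₀ θ.b₁ Mstar) U => QGQOfQY x.toKIdx (𝔮 x) (𝔮s x) (T₀ x) U)
    (fun (x : MemberY θ.d₆ θ.ℓ₆ θ.hd' θ.hL' θ.b₀ θ.b₁ Mstar) U => QGQOfQY x.toKIdx (𝔮 x) (𝔮s x) (T₀ x) U) hcoA hdec hcoA hdec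

end Summit.QuantumFields.YangMills.BalabanUVNodes.N06Eq3132SlotAKnitQJ

end
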